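import Summits.Langlands.Langlands.Theses.EisensteinGelfandKirillov
import Summits.Langlands.Langlands.Theorems.EisensteinGelfandKirillovProModularOfGKBoundDefs
import Summits.Langlands.Langlands.Theorems.EisensteinGelfandKirillovProModularOfGKBoundStubReadout
import Summits.Langlands.Langlands.Theorems.ReducibleOrdinaryProModular.Negative.LevelAndRamification
import Literature.NumberTheory.GaloisRepresentations.Pseudocharacter
import Literature.NumberTheory.Automorphic.GLnAdelicStructureProofs

/-!
# Line `eisenstein-fern` — checked skeleton for the crux
`Summit.Langlands.Langlands.Theses.EisensteinGelfandKirillov.ProModularOfGKBound` (stmt-Langlands-18273)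

Planner crux-plan, round 1 (idea card `Cruxes/ProModularOfGKBound/Ideas/eisenstein-fern.md`, triage
`TRIAGE-r1-{1,2,3}.md`: pass ×3, merged with `two-leaf-fern`; line card `Lines/eisenstein-fern.md`).

Four registered stubs `stub_*` (each `theorem stub_X : <signature> := by sorry`, a genuine lemma of the
line stated over existing declarations plus the abbreviations of the Vocabulary section) and the
kernel-checked composition `ProModularOfGKBound_of : stub_seed → stub_evilBranch → stub_fern →
stub_readout → ProModularOfGKBound` (hypotheses = the stub statements BY NAME via `type_of%`,
conclusion = the route decl BY NAME; pattern of `Cruxes/OddNonRegularAttached/Lines/birth.lean`).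

## The crux as typed, and what the line must therefore prove

`ProModularOfGKBound := EisensteinGKBound → Q` with the door `EisensteinGKBound` TRUE AS TYPED (level
collapse; `Cruxes/EisensteinGKBound/Disproof.lean`, line `levelcollapse`), hence the crux IS the bare
pro-modularity statement `Q` of the sector (`Disproof.proModularOfGKBound_iff_proModularity_of_door`).
This line is DOOR-FREE by design (the door hypothesis is bound and left idle in `ProModularOfGKBound_of`):
it proves `Q` from a SEED by the Eisenstein infinite fern.  `Q`: `F` totally real, `p ≥ 5`, `p ∤ disc F`,
`ρ : Γ_F → GL₂(ℚ̄_p)` irreducible, totally odd, a.e. unramified, residually upper-triangular (`ρ₀`) and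
`p`-distinguished at `v ∣ p` ⟹ `∃ 𝒰, 𝒰.IsPadicallyAutomorphic ρ`.

## The line (R^ps-free typing)

The tree has no universal pseudo-deformation ring `R^ps`, no rigid generic fibre, no structure sheaf on
its `Eigenvariety` interface.  Every statement below is therefore typed through three honest stand-ins,
all over existing declarations:

* `OnCommonComponent S ρ r` — "`𝔭_ρ` and `𝔭_r` lie on one irreducible component of `Spec R^ps_S`":
  there is an IRREDUCIBLE `p`-ADIC FAMILY through both, i.e. a compact Hausdorff Noetherian local DOMAIN
  `A` (intended `R^ps_S/P`, `𝔪`-adic topology) with a continuous `2`-dimensional pseudocharacter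
  `T : Γ_F → A` unramified outside `S` and continuous points `x y : A → ℚ̄_p` with `x ∘ T = tr ρ`,
  `y ∘ T = tr r` (faithful: a component `V(P)` gives `A = R^ps/P`; conversely the universal property of
  `R^ps` on profinite local algebras maps `R^ps → A`, whose irreducible image contains both primes).
* `IsFernPoint S hcpt ι r` — a GOOD CLASSICAL EISENSTEIN POINT: `r` irreducible, non-CM (irreducible on
  every quadratic extension), Satake–Frobenius compatible off `S` with a cuspidal regular algebraic `π`
  on `GL₂(𝔸_F)` that is unramified at `v ∣ p` with `φ`-GENERIC Satake parameters there (`α ≠ β`,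
  `α/β ≠ q_v^{±1}`).  Crystallinity at `p`, Hodge–Tate regularity and genericity at `v ∈ S ∖ S_p`
  (`H⁰(G_v, ad r(1)) = 0`) are CONSEQUENCES (local–global compatibility, generic local components of
  cuspidal `π`, Blasius–Ramanujan) to be derived inside `stub_fern`, not hypotheses.
* `DenseHeckeFamily 𝒰 ρ` — the fern's OUTPUT: a compact Hausdorff domain `A` (intended `R^ps_S/P_C`)
  carrying elements `a v i`, `b v` (the family's `T_{v,i}`- and `S_v⁻¹`-eigenvalues, `v ∉ 𝒰.bad`), a
  family of continuous points `pt k : A → ℚ̄_p` that is ZARISKI DENSE (`⋂ ker (pt k) = 0`) each of which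
  is a CONTINUOUS level-`𝒰` Hecke eigensystem with those eigenvalues, and one continuous point `x`
  whose eigenvalues are `tr ρ(Frob_v)` and `det ρ(Frob_v)/q_v`.

Data flow of `ProModularOfGKBound_of`:
* `stub_seed` — THE SEED (hardest; OPEN in general): the component of `ρ` carries a good classical
  point — a finite `S ⊇ S_p ∪ Ram(ρ)`, `ι`, and `r` with `IsFernPoint S hcpt ι r ∧ OnCommonComponent S ρ r`.
  In print for `F/ℚ` abelian, `χ̄_a/χ̄_b` extending to `Γ_ℚ`, `p` split completely (Pan2022 Lemma
  7.2.1 / Cor 7.2.3 + Thm 5.1.2; Zhang arXiv:2411.18661) and, by the deciding triager's two-ring Krull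
  count, for `#{v ∣ p} ≥ 2 + δ_F`; OPEN at `#{v ∣ p} ≤ 1 + δ_F` (inert `p` in a real quadratic field) and
  over non-abelian `F` (Skinner–Wiles Thm B territory).  `promote-stub` material = the route's foreseen
  `NicePrimeSeed`.
* `stub_evilBranch` — Gouvêa–Mazur's move (L): from a good classical point `r₀` on the component of `ρ`
  to a good classical point `r` on it that is moreover LOCALLY IRREDUCIBLE at every `v ∣ p` (both
  refinements non-critical): `r₀` is a smooth point of `𝔛_S` (Newton–Thorne `H¹_f(F, ad⁰ r₀) = 0`, no
  residual hypothesis, + Poitou–Tate), so the all-`β` (critical-slope) eigenvariety component through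
  `r₀^β` lies in the component of `ρ`; its large-weight classical points have slope in `(0, k-1)` at every
  `v ∣ p`, hence are old at `p`, non-ordinary, locally irreducible.  No local non-splitness of `r₀` needed.
* `stub_fern` — THE LEVER (XL; C⁺ of the card): a component of `Spec R^ps_S` through a locally
  irreducible good classical point has Zariski-dense classical cuspidal level-`K^p(N)` points, output as
  `DenseHeckeFamily 𝒰 ρ` with `S ⊆ 𝒰.bad`.  Internal programme: Chenevier's "ps-def = def" at the
  irreducible point; tangent spaces `T_α, T_β` of the two refinement leaves = `tangentSpaceWith S r L_{α/β}`
  (tree `GlobalTriangulineSpace`; landed `fernSpanCriterion`/`twoLeaf_span`, p142582) spanning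
  `H¹_S(Γ_F, ad r)` by (i) Nakamura's two-leaf local theorem for `n = 2`, ANY `F_v` (arXiv:1006.4891 §2)
  and (ii) Newton–Thorne (arXiv:1912.11265 Thm 2) via Greenberg–Wiles; eigenvariety of `GL₂/F` of tame
  level `K^p(N)` at the Eisenstein `𝔪` (Hansen; AIP; Buzzard for `D` totally definite) with Galois
  determinants, KPX global triangulation (strict at non-critical points), étale over weight space at
  non-critical classical points (Chenevier Thm D pattern; Bergdall–Hansen); Chenevier's accumulation
  ("infection") lemma arXiv:0911.5726 §2–3; conductor at `v ∈ S ∖ S_p` constant on the component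
  (`H²(G_v, ad) = 0` at cuspidal points) so ONE tame level `N` serves; classical cuspidal eigensystems
  of level `K^p(N)K_r` are continuous points of `𝕋(𝒰_N)` (Eichler–Shimura–Harder, Carayol/Taylor).
* `stub_readout` — (M, provable now) `DenseHeckeFamily 𝒰 ρ` + `ρ` unramified outside `𝒰.bad` ⟹
  `𝒰.IsPadicallyAutomorphic ρ`: `a ↦ (pt k a)_k` is a closed embedding `A ↪ ∏_k ℚ̄_p` (compact →
  Hausdorff); `T_{v,i} ↦ a v i`, `S_v⁻¹ ↦ b v` is a well-defined (density) continuous (memberwise) ring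
  map on the dense subring generated by `𝒰.heckeGenerators`, extends to `𝕋(𝒰) → A` by uniform
  continuity; compose with `x`; `charpoly = X² − tr·X + det` (`Matrix.charpoly_fin_two`) gives
  `IsAssociated`.

## Disproof.lean (cdisprove cycle 1) — what this skeleton honours

* `proModularOfGKBound_iff_proModularity_of_door`: door idle ⇒ prove `Q`; done (door bound, unused).
* `not_proModularityWithoutAEUnramified_of` (a.e.-unramified is load-bearing modulo
  `InfinitelyRamifiedSectorRep`): the line USES `hur` — at `stub_seed` (`S ⊇ Ram ρ`, finite) and at
  `stub_readout` (association needs `ρ` unramified outside `𝒰.bad ⊇ S`).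
* Load-bearing table: irreducibility, oddness, residual upper-triangularity and `p`-distinguishedness
  are consumed by `stub_seed` only (Pan/Skinner–Wiles seed), exactly as the table predicts ("load-bearing
  for the route's proof, plausibly not for truth"); `stub_fern` needs none of them.
* §Pre-targets: `HeckeDimOfGKBound` (false as typed) and `reducibleLocus_cutOut` (misstated) are NOT used;
  the fern cards' falsifier (1) PASSED (no `f+1` obstruction at inert `p`).
* Landed Negative lemmas (imported above): `bad_of_not_isUnramifiedAt`, `not_isPadicallyAutomorphic_full`
  ⇒ the tame level must contain `Ram(ρ)`: `stub_fern` outputs `S ⊆ 𝒰.bad` with `S ⊇ Ram(ρ)`; no stub is an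
  instance they refute (`example` at the end of the file).
* Negatives index (`ledger negatives --problem Langlands`, 4 entries: 16951, 16822, 17212, 3797): none
  concerns pseudo-deformation families, eigenvarieties or pro-modularity.
-/

set_option linter.dupNamespace false
set_option linter.unusedVariables false

noncomputable section

open scoped NumberField Polynomial
open IsDedekindDomain Filter Topology
open Literature.NumberTheory.GaloisRepresentations Literature.NumberTheory.Automorphic
open Literature.NumberTheory.Automorphic.BigHeckeGLn

namespace Summit.Langlands.Langlands.Cruxes.ProModularOfGKBound.EisensteinFern

variable {F : Type} [Field F] [NumberField F] {p : ℕ} [Fact p.Prime]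

/-! ## Vocabulary

The line's vocabulary (`Pl`, `OnCommonComponent`, `IsFernPoint`, `LocallyIrreducibleAbove`,
`heckeSinv`, `DenseHeckeFamily`) now lives in the LANDED Defs module
`Summits.Langlands.Langlands.Theorems.EisensteinGelfandKirillovProModularOfGKBoundDefs` (p151867,
2026-08-17, lead a2), declared in this namespace — imported above, byte-identical to the planner's
inline copies, so the registered stub signatures are unchanged. -/

/-! ## The four stubs (registered: `theorem stub_X : <signature> := by sorry`) -/

/-- **Stub 1 — THE SEED (hardest; open in general).**  For `(F, p, ρ, ρ₀)` in the sector of the crux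
there are a finite set `S` of finite places containing those above `p` and those where `ρ` ramifies,
an `ι : ℚ̄_p ≃ ℂ`, and a GOOD CLASSICAL POINT `r` on a common irreducible component with `ρ` of the
pseudo-deformation space unramified outside `S`.  Intended proof (Pan's architecture, Galois side only):
`C ∋ 𝔭_ρ` has `dim ≥ 1 + 2[F:ℚ]` (`ρ` irreducible odd: `h⁰(ad⁰) = 0`, Pan2022 Lemma 7.1.3); its ordinary
locus `C^{ord}` is cut out place by place and maps finitely onto weight space `Λ_F` (Pan Lemma 7.2.1 /
Cor 7.2.3 for `F_v = ℚ_p` via Paškūnas B.20; two-ring Krull count of TRIAGE-r1-3 for `#{v∣p} ≥ 2+δ_F`);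
its regular de Rham points are classical cuspidal ordinary (Pan Thm 5.1.2 = Skinner–Wiles: `F` abelian,
`p` unramified, `χ̄_a/χ̄_b` from `Γ_ℚ`, `p`-distinguished), dense in a `(d+1+δ)`-dimensional family in
`C`, hence include non-CM `φ`-generic ones (CM points of bounded tame level lie on finitely many
lower-dimensional CM families; ordinary ⇒ `α ≠ β`).  OPEN: `#{v∣p} ≤ 1+δ_F` (inert `p`, the route's
showcase) and non-abelian `F` / `χ̄` not from `Γ_ℚ` — file as the route item `NicePrimeSeed`. -/
theorem stub_seed :
    ∀ (F : Type) [Field F] [NumberField F], NumberField.IsTotallyReal F →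
    ∀ (p : ℕ) [Fact p.Prime], 5 ≤ p → ¬ ((p : ℤ) ∣ NumberField.discr F) →
    ∀ (O : ValuationSubring (PadicAlgCl p)),
      O = (Valued.v : Valuation (PadicAlgCl p) NNReal).valuationSubring →
    ∀ (ρ : FramedGaloisRep F (PadicAlgCl p) 2)
      (ρ₀ : Field.absoluteGaloisGroup F →* Matrix.GeneralLinearGroup (Fin 2) O),
      ρ.toGaloisRep.IsIrreducible → ρ.IsOdd → (∀ᶠ v in cofinite, ρ.IsUnramifiedAt v) →
      ρ.HasUpperTriangularIntegralModel ρ₀ →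
      (∀ v : Pl F, ((p : ℕ) : 𝓞 F) ∈ v.asIdeal → IsPDistinguishedAt ρ₀ v) →
    ∀ (hcpt : isCompact_glFiniteIntegralLevel 2 F),
      ∃ (S : Set (Pl F)), S.Finite ∧ (∀ v : Pl F, ((p : ℕ) : 𝓞 F) ∈ v.asIdeal → v ∈ S) ∧
        (∀ v ∉ S, ρ.IsUnramifiedAt v) ∧
        ∃ (ι : PadicAlgCl p ≃+* ℂ) (r : FramedGaloisRep F (PadicAlgCl p) 2),
          IsFernPoint S hcpt ι r ∧ OnCommonComponent S ρ r := by
  sorry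

/-- **Stub 2 — THE EVIL BRANCH (Gouvêa–Mazur's move; L).**  A good classical point `r₀` on the
component of `ρ` can be traded for a good classical point `r` on the same component that is LOCALLY
IRREDUCIBLE at every `v ∣ p`.  Intended proof: `r₀` is a smooth point of the pseudo-deformation space
`𝔛_S` (Chenevier: ps-deformations = deformations at the irreducible `r₀`; `H²(G_{F,S}, ad⁰ r₀) = 0`
because the local `H⁰(G_v, ad⁰ r₀(1))` vanish — generic local components of the cuspidal `π`,
Blasius–Ramanujan at `v ∣ p` — and `Ш¹(ad⁰ r₀(1)) ⊆ H¹_f(F, ad⁰ r₀(1)) = 0` by Newton–Thorne Thm 2 +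
Greenberg–Wiles parity), so the unique component through `r₀` is that of `ρ`; the irreducible component
of the tame-level-`K^p` eigenvariety through the all-`β` refinement `r₀^β` (Newton bound `d+1+δ`,
classical points dense by small-slope classicality) maps into it; on that component the `U_v`-slopes are
locally constant `= k_{0}-1 > 0`, so classical points of large weight are old at `p` (unramified `π_v`,
`φ`-generic) and NON-ORDINARY at every `v ∣ p`, hence crystalline reducible is impossible: locally
irreducible; non-CM and Satake compatibility off `S` persist generically. -/
theorem stub_evilBranch :
    ∀ (F : Type) [Field F] [NumberField F], NumberField.IsTotallyReal F →
    ∀ (p : ℕ) [Fact p.Prime], 5 ≤ p → ¬ ((p : ℤ) ∣ NumberField.discr F) →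
    ∀ (S : Set (Pl F)), S.Finite → (∀ v : Pl F, ((p : ℕ) : 𝓞 F) ∈ v.asIdeal → v ∈ S) →
    ∀ (hcpt : isCompact_glFiniteIntegralLevel 2 F) (ι : PadicAlgCl p ≃+* ℂ)
      (ρ r₀ : FramedGaloisRep F (PadicAlgCl p) 2),
      IsFernPoint S hcpt ι r₀ → OnCommonComponent S ρ r₀ →
      ∃ r : FramedGaloisRep F (PadicAlgCl p) 2,
        IsFernPoint S hcpt ι r ∧ LocallyIrreducibleAbove p r ∧ OnCommonComponent S ρ r := by
  sorry

/-- **Stub 3 — THE FERN (the lever; XL; the card's Transfer `C⁺`).**  If `ρ` (`F` totally real, `p ≥ 5`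
unramified in `F`) lies on a common irreducible component of the pseudo-deformation space unramified
outside the finite `S ⊇ S_p` with a good classical point `r` that is locally irreducible above `p`, then
`ρ` lies on a Zariski-dense Hecke family of some tame level `𝒰` with `S ⊆ 𝒰.bad`.  Intended proof
(Chenevier's infinite fern at the Eisenstein pseudo-deformation space): at every good classical point
`y` of the component (smooth, `dim 2d+1+δ_F`, by Newton–Thorne + Poitou–Tate as in Stub 2) the two
refinement leaves `E_α(y), E_β(y)` of the tame-level-`K^p(N)` eigenvariety (`N` = prime-to-`p` conductor
of `r`, constant on the component) are `(d+1+δ_F)`-dimensional, étale over weight space (both refinements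
non-critical: `y` locally irreducible), with Galois families trianguline of the two opposite orderings
(KPX), so their images have tangent spaces `T_α, T_β ⊆ H¹_S(Γ_F, ad r_y)` meeting in the `(1+δ_F)`-
dimensional twist directions (locally Nakamura's two-leaf theorem `L_α ∩ L_β = H¹_f(ad⁰) ⊕ H¹(1)`, any
`F_v`, `n = 2`; globally `H¹_f(F, ad⁰ r_y) = 0`, Newton–Thorne) and spanning it (`fernSpanCriterion`,
landed p142582); Chenevier's accumulation lemma then puts the whole component inside the Zariski closure
of classical cuspidal level-`K^p(N)` points; take `A = R^ps_S/P_C`, `a v 1 = T(Frob_v)`,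
`a v 2 = D(Frob_v)/q_v`, `b v = (a v 2)⁻¹`, `pt` = those classical points (continuous points of `𝕋(𝒰_N)`
by Eichler–Shimura–Harder + Carayol/Taylor/Blasius–Rogawski), `x = 𝔭_ρ`. -/
theorem stub_fern :
    ∀ (F : Type) [Field F] [NumberField F], NumberField.IsTotallyReal F →
    ∀ (p : ℕ) [Fact p.Prime], 5 ≤ p → ¬ ((p : ℤ) ∣ NumberField.discr F) →
    ∀ (S : Set (Pl F)), S.Finite → (∀ v : Pl F, ((p : ℕ) : 𝓞 F) ∈ v.asIdeal → v ∈ S) →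
    ∀ (hcpt : isCompact_glFiniteIntegralLevel 2 F) (ι : PadicAlgCl p ≃+* ℂ)
      (ρ r : FramedGaloisRep F (PadicAlgCl p) 2),
      (∀ v ∉ S, ρ.IsUnramifiedAt v) → IsFernPoint S hcpt ι r → LocallyIrreducibleAbove p r →
      OnCommonComponent S ρ r →
      ∃ 𝒰 : TameLevel 2 F p, S ⊆ 𝒰.bad ∧ DenseHeckeFamily 𝒰 ρ := by
  sorry

/-! **Stub 4 — THE READOUT: LANDED** (p152781, 2026-08-17, wave 1 of lead a2):
`Summit.Langlands.Langlands.Cruxes.ProModularOfGKBound.EisensteinFern.stub_readout` in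
`Theorems/EisensteinGelfandKirillovProModularOfGKBoundStubReadout.lean` (imported above; sorry-free,
axioms propext/Classical.choice/Quot.sound): a `ρ` unramified outside `𝒰.bad` lying on a Zariski-dense
Hecke family of level `𝒰` is `p`-adically automorphic of level `𝒰` (closed-embedding argument
`A ↪ ∏_k ℚ̄_p`, closed subring of `𝕋(𝒰)` containing the generators is everything, `charpoly_fin_two` +
`heckeFrobPoly_two`).  The composition below uses it BY NAME; it is no longer a hypothesis. -/

/-! ## The stub statements as named `Prop`s (literally their types) -/

namespace _Goal

/-- The statement of `stub_seed`, as a named `Prop` (literally its type). -/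
def stub_seed : Prop :=
  type_of% @Summit.Langlands.Langlands.Cruxes.ProModularOfGKBound.EisensteinFern.stub_seed

/-- The statement of `stub_evilBranch`, as a named `Prop` (literally its type). -/
def stub_evilBranch : Prop :=
  type_of% @Summit.Langlands.Langlands.Cruxes.ProModularOfGKBound.EisensteinFern.stub_evilBranch

/-- The statement of `stub_fern`, as a named `Prop` (literally its type). -/
def stub_fern : Prop :=
  type_of% @Summit.Langlands.Langlands.Cruxes.ProModularOfGKBound.EisensteinFern.stub_fern

end _Goal

/-! ## The composition: the three open stubs + the landed readout imply the crux, by name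
(kernel-checked, no `sorry` of its own) -/

/-- **`ProModularOfGKBound` from the four stubs.**  The door hypothesis is bound and left idle (the crux
as typed is the bare pro-modularity `Q`; Disproof `proModularOfGKBound_iff_proModularity_of_door`).  Given
`(F, p, O, ρ, ρ₀)` in the sector: `stub_seed` gives `S ⊇ S_p ∪ Ram(ρ)`, `ι` and a good classical `r₀` on
the component of `ρ`; `stub_evilBranch` upgrades it to a locally irreducible good `r` on the same
component; `stub_fern` yields a tame level `𝒰` with `S ⊆ 𝒰.bad` and a Zariski-dense Hecke family of level
`𝒰` through `ρ`; `stub_readout` reads off `𝒰.IsPadicallyAutomorphic ρ` (`ρ` is unramified outside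
`𝒰.bad ⊇ S`) — the LANDED theorem `stub_readout` (p152781), used by name.  Hypotheses = the three
open stub statements by name; conclusion = the route decl by name. -/
theorem ProModularOfGKBound_of (h₁ : _Goal.stub_seed) (h₂ : _Goal.stub_evilBranch)
    (h₃ : _Goal.stub_fern) :
    Summit.Langlands.Langlands.Theses.EisensteinGelfandKirillov.ProModularOfGKBound := by
  -- the stub statements, as the Π-types they literally are
  have hseed : type_of% @stub_seed := h₁
  have hevil : type_of% @stub_evilBranch := h₂
  have hfern : type_of% @stub_fern := h₃
  intro _door F _ _ hF p _ hp hdisc O hO ρ ρ₀ hirr hodd hur hup hdist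
  -- SEED: `S`, `ι` and a good classical point on the component of `ρ`
  obtain ⟨S, hSfin, hSp, hSur, ι, r₀, hr₀, hcc₀⟩ :=
    hseed F hF p hp hdisc O hO ρ ρ₀ hirr hodd hur hup hdist (isCompact_glFiniteIntegralLevel_holds 2 F)
  -- EVIL BRANCH: make the good point locally irreducible above `p`
  obtain ⟨r, hr, hli, hcc⟩ :=
    hevil F hF p hp hdisc S hSfin hSp (isCompact_glFiniteIntegralLevel_holds 2 F) ι ρ r₀ hr₀ hcc₀
  -- FERN: a Zariski-dense Hecke family of some tame level through `ρ`
  obtain ⟨𝒰, hS𝒰, hfam⟩ :=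
    hfern F hF p hp hdisc S hSfin hSp (isCompact_glFiniteIntegralLevel_holds 2 F) ι ρ r hSur hr hli hcc
  -- READOUT
  exact ⟨𝒰, stub_readout F p 𝒰 ρ (fun v hv => hSur v fun hvS => hv (hS𝒰 hvS)) hfam⟩

/-- By-name sanity check (an `example`, not a declaration of the file): the three open stubs feed the
composition as they stand (the fourth, `stub_readout`, is landed and used inside). -/
example : Summit.Langlands.Langlands.Theses.EisensteinGelfandKirillov.ProModularOfGKBound :=
  ProModularOfGKBound_of stub_seed stub_evilBranch stub_fern

/-- Consistency with the landed Negative lemma `bad_of_not_isUnramifiedAt` (level and ramification): the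
tame level read out by the line contains every place where `ρ` ramifies — here in the form the
composition uses it: a place outside `𝒰.bad ⊇ S` is a place of good reduction of `ρ`. -/
example (S : Set (Pl F)) (𝒰 : TameLevel 2 F p) (ρ : FramedGaloisRep F (PadicAlgCl p) 2)
    (hSur : ∀ v ∉ S, ρ.IsUnramifiedAt v) (hS𝒰 : S ⊆ 𝒰.bad) : ∀ v ∉ 𝒰.bad, ρ.IsUnramifiedAt v :=
  fun v hv => hSur v fun hvS => hv (hS𝒰 hvS)

end Summit.Langlands.Langlands.Cruxes.ProModularOfGKBound.EisensteinFern

end
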